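import Summits.QuantumFields.YangMills.Theorems.UnitScaleTiltProp7ExistRouteAlphaMinGCtr
import HarnessLib

/-!
# Route `UnitScaleTilt`, crux K1 child «MinimiserStabilityRegPr» (stmt-QuantumFields-19200), skeleton v10, stub `stub_existenceMinimalOrbit` (EX), route (α),
# DENSITY line (★★OWNER RULING g28-№8 (B)) — **(D1) «MACRO-SECTOR»: the sed-twin of the re-centred route-(α) spine ✓p672002
# `Prop7ExistRouteAlphaMinGCtr.existenceMinimalOrbit_of_CminG_covCtr` with (a) the competitor's radius DECOUPLED from the minimiser's — minimality over
# `(6)(ρ)` for EVERY `ρ ∈ [O₁L³B₃ε₁, ρ₀]`, `ρ₀` absolute (exactly as ★`Prop7ClosedFibreInteriorOfRouteAlpha.isMinOn_macro_of_Cmin_cov` did for the v2 spine) — and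
# (b) an OPAQUE SECTOR PREDICATE `Sec F n V` on the data threaded through the re-centring row `hS` and the conclusion**

Cell `ym3-torus`, width seat `ym3-torus-px10` (gen 3).  THEOREMS ONLY (0 `def`, 0 `sorry`).  `--supports stmt-QuantumFields-19200 --as helper`,
count-neutral.  YM₃ on T³ is a ladder rung (R3), not the Clay problem; nothing here claims the stub, the crux, d = 4 or the mass gap.

WHY.  The conclusion is VERBATIM the hypothesis `hmacro` of ✓p674041 `Prop7ExistenceByDensityLimit.existenceMinimalOrbit_of_macroSector_dense_localSurj`: on the
sector `Sec := «every V-parallel M₂(ℂ)-section is scalar»` the row `hS` is INHABITED by the stub's own background (`U₁ := U₀`, lift by ✓p671081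
`hLift_of_onlyScalarParallel`), so the DENSITY knit displays exactly the S7′ chain's rows `hC` (lifted C-minˢ) and `hV` (COV) — no `hSymCentre`.

WHAT IS PROVED (sorry-free, no definition; ns `…Theorems.Prop7ExistRouteAlphaMinGCtrMacroSector`):
★★ `isMinOn_macroSector_of_CminG_covCtr (hL) (hB₃) (Lan) (Lift) (Sec) (hC) (hV) (hS)` — `hC`, `hV` = ✓p672002's BYTES; `hS` = ✓p672002's row with ONE antecedent
`Sec i.1.1 i.1.2.1 V →` inserted before `PlaqSmall ε₁ V →`; conclusion = ★`isMinOn_macro_of_Cmin_cov`'s shape with `Sec F n V →` inserted before `PlaqSmall ε₁ V →`: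
`∃ ρ₀ a₁' O₁, 0 < ρ₀ ∧ 0 < a₁' ∧ 1 ≤ O₁ ∧ ∀ F, F.L = L → ∀ n K hnK ε₁, 0 < ε₁ → ∀ V, Sec F n V → PlaqSmall ε₁ V → ∀ U₀, RegPr … (L³B₃ε₁) U₀ → U₀ ∈ 𝔅_k(V) → ε₁ ≤ a₁' →
O₁L³B₃ε₁ ≤ ρ₀ ∧ ∃ W ∈ regFibrePr … (O₁L³B₃ε₁) V, ∀ ρ, O₁L³B₃ε₁ ≤ ρ → ρ ≤ ρ₀ → IsMinOn A (regFibrePr … ρ V) W`.  Constants as in the two parents: `M = max{1, 3B₀}`,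
`O₁ = 178M`, `ρ₀ = min{e_ax, c₁∕2, a₄∕(2B₁)}`, `a₁' = min{(five smallness bounds), aS}`.  Proof = ★`isMinOn_macro_of_Cmin_cov`'s body with ✓p672002's three G∕CTR edits
(`AvgCondPrintS`∕`Lan`, `Lift` fed to `hC`, re-centring by `hS`), nothing else.

HONEST SCOPE.  Bookkeeping twin; `hC`, `hV`, `hS` are DISPLAYED (hypotheses); nothing of [Balaban1985Variational] is asserted beyond the parents; no stub ∕ crux
statement is advanced; YM₃ on T³ = rung R3 — not d = 4, not infinite volume, not a mass gap, not Clay.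

References: T. Bałaban, CMP 102 (1985) 277–309 [Balaban1985Variational] (Prop. 7 p.299, (112) p.294, (116) p.295, (141)–(142) p.299); CMP 99 (1985) 75–102
[Balaban1985RegularSpaces] (Thm 2 p.83, (1.19) p.79, (1.28)–(1.30) p.81).
-/

set_option autoImplicit false

noncomputable section

open scoped Matrix.Norms.L2Operator

namespace Summit.QuantumFields.YangMills.Theorems.Prop7ExistRouteAlphaMinGCtrMacroSector

open Literature.MathematicalPhysics.QuantumFieldTheory.Balaban1983to89
open Literature.MathematicalPhysics.QuantumFieldTheory.Balaban1983to89.T3ContinuumYM3Torus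
open Literature.MathematicalPhysics.QuantumFieldTheory.Balaban1983to89.T3UnitLawDensityEML (ℰp)
open Literature.MathematicalPhysics.QuantumFieldTheory.Balaban1983to89.T3DescentFibreTower
open Literature.MathematicalPhysics.QuantumFieldTheory.Balaban1983to89.T3ConstrainedMinimiser
open Literature.MathematicalPhysics.QuantumFieldTheory.Balaban1983to89.T3TiltDescent
open Literature.MathematicalPhysics.QuantumFieldTheory.Balaban1983to89.T3PrintedRegularMinimiser
open Literature.MathematicalPhysics.QuantumFieldTheory.Balaban1983to89.T3PrintedMinimiserExistence (regPr_mono)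
open Literature.MathematicalPhysics.QuantumFieldTheory.Balaban1983to89.T3PrintedRegularOrbits (descTransf regPr_gaugeAct_iff gaugeAct_mem_regFibrePr_iff_of_trivial)
open Literature.MathematicalPhysics.QuantumFieldTheory.Balaban1983to89.T3Thm1Carrier
open Literature.MathematicalPhysics.QuantumFieldTheory.Balaban1983to89.T3SectALandauChart
open B7Prop2Explicit (C0 c2' C0_pos c2'_pos)
open B8Thm4TorusAt (torusLam)
open Summit.QuantumFields.YangMills.Theorems.Prop7TPrint
open Summit.QuantumFields.YangMills.Theorems.Prop7SPrint
open Summit.QuantumFields.YangMills.Theorems.Prop7PV3CDELogChart (in19_expHermField_of_nMax19_lt nMax19_lt_of_in19 eq_expHermField_of_in19)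
open Summit.QuantumFields.YangMills.Theorems.Prop7B8Prop7Div (regPr_emb15_of_in19)
open Summit.QuantumFields.YangMills.Theorems.Prop7ChartPrint (axialRepr_print_based_uniform)

variable {L : ℕ}

/-- ★★ **MACRO-SECTOR — the re-centred route-(α) spine with the competitor's radius decoupled and a sector predicate on the data.**  For `ε₁ ≤ a₁′` and every
datum `V` of the sector (`Sec F n V`) with `PlaqSmall ε₁ V` and a background `U₀ ∈ 𝔘_k(L³B₃ε₁) ∩ 𝔅_k(V)`: `hS` re-centres at `U₀* ∈ 𝔅_k(V) ∩ 𝔘_k(L³B₃ε₁)` carrying `Lift`,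
C-minˢ gives the minimising `X` at `U₀*`, its `NormS`-representative `W = (e^{iX}U₀*)^u ∈ (6)(O₁L³B₃ε₁) ∩ 𝔅_k(V)`, and for EVERY `ρ ∈ [O₁L³B₃ε₁, ρ₀]` a competitor
`U ∈ (6)(ρ) ∩ 𝔅_k(V)` is moved to the axial gauge ((1.19), `ρ ≤ e_ax`), charted by COV at `ε₂ = B₁(ρ + L³ε₁) ≤ a₄`, and compared through the gauge invariance of (5).
[cite: Balaban1985Variational, Prop. 7 p.299, (112) p.294, (116) p.295, (141)-(142) p.299; Balaban1985RegularSpaces, Thm 2 p.83, (1.19) p.79] -/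
theorem isMinOn_macroSector_of_CminG_covCtr (hL : 1 < L) {B₃ : ℝ} (hB₃ : 4 < B₃) (Lan : ∀ i : Idx L, GaugeField (i.1.1.P i.1.2.2) 0 (Matrix.specialUnitaryGroup (Fin 2) ℂ) → (PBond (i.1.1.P i.1.2.2) 0 → Matrix (Fin 2) (Fin 2) ℂ) → Prop)
    (Lift : ∀ i : Idx L, GaugeField (i.1.1.P i.1.2.2) 0 (Matrix.specialUnitaryGroup (Fin 2) ℂ) → Prop)
    (hC : ∃ B₀ a₄ : ℝ, 0 < B₀ ∧ 0 < a₄ ∧ ∀ (i : Idx L) (ε₁ ε₄ : ℝ), 0 < ε₁ → ε₄ ≤ a₄ → 2 * B₀ * (L : ℝ) ^ 3 * B₃ * ε₁ ≤ ε₄ →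
        ∀ (V : GaugeField (i.1.1.P i.1.2.1) 0 (Matrix.specialUnitaryGroup (Fin 2) ℂ)) (U₀ : GaugeField (i.1.1.P i.1.2.2) 0 (Matrix.specialUnitaryGroup (Fin 2) ℂ)),
          PlaqSmall ε₁ V → RegPr i.1.1 i.1.2.1 i.1.2.2 ((L : ℝ) ^ 3 * B₃ * ε₁) U₀ → CloseAvg i.1.1 i.1.2.1 i.1.2.2 i.2.2.le ((L : ℝ) ^ 3 * ε₁) V U₀ → Lift i U₀ →
          ∃ X : PBond (i.1.1.P i.1.2.2) 0 → Matrix (Fin 2) (Fin 2) ℂ,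
            nMax19 i.1.1 i.1.2.1 i.1.2.2 U₀ X < 3 * B₀ * (L : ℝ) ^ 3 * B₃ * ε₁ ∧ (∀ b : PBond (i.1.1.P i.1.2.2) 0, (X b).IsHermitian ∧ Matrix.trace (X b) = 0) ∧
            AvgCondPrintS i.1.1 i.1.2.1 i.1.2.2 i.2.2.le V U₀ X ∧ Lan i U₀ X ∧
            ∀ X' : PBond (i.1.1.P i.1.2.2) 0 → Matrix (Fin 2) (Fin 2) ℂ, nMax19 i.1.1 i.1.2.1 i.1.2.2 U₀ X' < ε₄ → (∀ b : PBond (i.1.1.P i.1.2.2) 0, (X' b).IsHermitian ∧ Matrix.trace (X' b) = 0) →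
              AvgCondPrint i.1.1 i.1.2.1 i.1.2.2 i.2.2.le V U₀ X' → IsLandauPrint i.1.1 i.1.2.1 i.1.2.2 U₀ X' →
                wilsonAction4 (emb15 U₀ (expHermField X)) ≤ wilsonAction4 (emb15 U₀ (expHermField X')))
    (hV : ∃ B₁ c₁ : ℝ, 0 < B₁ ∧ 0 < c₁ ∧ ∀ (F : T3Family) (hF : F.L = L) (n K : ℕ) (hnK : n < K) (ε₀ ε₁ ε₂ : ℝ), 0 < ε₀ → 0 < ε₁ →
        ε₀ + (L : ℝ) ^ 3 * ε₁ ≤ c₁ → B₁ * (ε₀ + (L : ℝ) ^ 3 * ε₁) ≤ ε₂ →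
        ∀ (V : GaugeField (F.P n) 0 (Matrix.specialUnitaryGroup (Fin 2) ℂ)) (U₀ : GaugeField (F.P K) 0 (Matrix.specialUnitaryGroup (Fin 2) ℂ)),
          RegPr F n K ((L : ℝ) ^ 3 * B₃ * ε₁) U₀ → CloseAvg F n K hnK.le ((L : ℝ) ^ 3 * ε₁) V U₀ →
          ∀ U : GaugeField (F.P K) 0 (Matrix.specialUnitaryGroup (Fin 2) ℂ), U ∈ regFibrePr F n K hnK.le ε₀ V → IsAxialPrint F n K U₀ U →
            ∃ (u : GaugeTransf (F.P K) 0 (Matrix.specialUnitaryGroup (Fin 2) ℂ)) (U₁ : GaugeField (F.P K) 0 (Matrix.specialUnitaryGroup (Fin 2) ℂ))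
              (X : PBond (F.P K) 0 → Matrix (Fin 2) (Fin 2) ℂ),
              RestrictedPrint F n K U₀ u ∧ GaugeField.gaugeAct u (emb15 U₀ U₁) = U ∧ In19 F n K ε₂ U₀ U₁ X ∧
                AvgCondPrint F n K hnK.le V U₀ X ∧ IsLandauPrint F n K U₀ X)
    (Sec : ∀ (F : T3Family) (n : ℕ), GaugeField (F.P n) 0 (Matrix.specialUnitaryGroup (Fin 2) ℂ) → Prop)
    -- the re-centring row of ✓p672002 ON THE SECTOR (in the DENSITY knit it is inhabited by `U₁ := U₀`)
    (hS : ∃ aS : ℝ, 0 < aS ∧ ∀ (i : Idx L) (ε₁ : ℝ), 0 < ε₁ → ε₁ ≤ aS →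
        ∀ (V : GaugeField (i.1.1.P i.1.2.1) 0 (Matrix.specialUnitaryGroup (Fin 2) ℂ)) (U₀ : GaugeField (i.1.1.P i.1.2.2) 0 (Matrix.specialUnitaryGroup (Fin 2) ℂ)),
          Sec i.1.1 i.1.2.1 V → PlaqSmall ε₁ V → RegPr i.1.1 i.1.2.1 i.1.2.2 ((L : ℝ) ^ 3 * B₃ * ε₁) U₀ → U₀ ∈ fibre i.1.1 ℰp i.1.2.1 i.1.2.2 i.2.2.le V →
          ∃ U₁ : GaugeField (i.1.1.P i.1.2.2) 0 (Matrix.specialUnitaryGroup (Fin 2) ℂ),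
            U₁ ∈ fibre i.1.1 ℰp i.1.2.1 i.1.2.2 i.2.2.le V ∧ RegPr i.1.1 i.1.2.1 i.1.2.2 ((L : ℝ) ^ 3 * B₃ * ε₁) U₁ ∧ Lift i U₁) :
    ∃ ρ₀ a₁' O₁ : ℝ, 0 < ρ₀ ∧ 0 < a₁' ∧ 1 ≤ O₁ ∧
    ∀ (F : T3Family), F.L = L → ∀ (n K : ℕ) (hnK : n < K) (ε₁ : ℝ), 0 < ε₁ →
      ∀ V : GaugeField (F.P n) 0 (Matrix.specialUnitaryGroup (Fin 2) ℂ), Sec F n V → PlaqSmall ε₁ V →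
        ∀ U₀ : GaugeField (F.P K) 0 (Matrix.specialUnitaryGroup (Fin 2) ℂ), RegPr F n K ((L : ℝ) ^ 3 * B₃ * ε₁) U₀ → U₀ ∈ fibre F ℰp n K hnK.le V →
          ε₁ ≤ a₁' → O₁ * (L : ℝ) ^ 3 * B₃ * ε₁ ≤ ρ₀ ∧
            ∃ W ∈ regFibrePr F n K hnK.le (O₁ * (L : ℝ) ^ 3 * B₃ * ε₁) V, ∀ ρ : ℝ, O₁ * (L : ℝ) ^ 3 * B₃ * ε₁ ≤ ρ → ρ ≤ ρ₀ →
              IsMinOn (fun W' : GaugeField (F.P K) 0 (Matrix.specialUnitaryGroup (Fin 2) ℂ) => wilsonAction4 W') (regFibrePr F n K hnK.le ρ V) W := by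
  have hL1 : (1 : ℝ) ≤ (L : ℝ) := by exact_mod_cast hL.le
  have hC₁ : (1 : ℝ) ≤ (L : ℝ) ^ 3 := one_le_pow₀ hL1
  have hC₁pos : (0 : ℝ) < (L : ℝ) ^ 3 := by positivity
  have hB₃0 : 0 < B₃ := by linarith
  have hB₃1 : 1 ≤ B₃ := by linarith
  have hC0 : 0 < C0 3 := C0_pos _
  have hc2 : 0 < c2' 3 L := c2'_pos _ _ hL.le
  set eax : ℝ := min (1 / (6 * C0 3 * (L : ℝ) ^ 3)) (c2' 3 L / (4 * (L : ℝ) ^ 3)) with heax_def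
  have heax : 0 < eax := lt_min (by positivity) (by positivity)
  obtain ⟨B₀, a₄, hB₀, ha₄, HC⟩ := hC
  obtain ⟨B₁, c₁, hB₁, hc₁, HV⟩ := hV
  obtain ⟨aS, haS, HS⟩ := hS
  set M : ℝ := max 1 (3 * B₀) with hM
  have hM1 : 1 ≤ M := le_max_left _ _
  have hM3 : 3 * B₀ ≤ M := le_max_right _ _
  have hM0 : 0 < M := lt_of_lt_of_le one_pos hM1
  -- the macroscopic radius
  set ρ₀ : ℝ := min eax (min (c₁ / 2) (a₄ / (2 * B₁))) with hρ₀_def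
  have hρ₀ : 0 < ρ₀ := lt_min heax (lt_min (by positivity) (by positivity))
  have hρ₀eax : ρ₀ ≤ eax := min_le_left _ _
  have hρ₀c₁ : ρ₀ ≤ c₁ / 2 := (min_le_right _ _).trans (min_le_left _ _)
  have hρ₀a₄ : ρ₀ ≤ a₄ / (2 * B₁) := (min_le_right _ _).trans (min_le_right _ _)
  have hK₁ : 0 < 2 * B₀ * (L : ℝ) ^ 3 * B₃ := by positivity
  have hK₄ : 0 < 178 * M * (L : ℝ) ^ 3 * B₃ := by positivity
  have hK₅ : 0 < M * (L : ℝ) ^ 3 * B₃ := by positivity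
  set a₁' : ℝ := min (min (min (min (a₄ / (2 * B₀ * (L : ℝ) ^ 3 * B₃)) ((c₁ / 2) / (L : ℝ) ^ 3)) ((a₄ / (2 * B₁)) / (L : ℝ) ^ 3))
    (ρ₀ / (178 * M * (L : ℝ) ^ 3 * B₃))) ((1 / 4) / (M * (L : ℝ) ^ 3 * B₃)) with ha₁'
  have ha₁'0 : 0 < a₁' :=
    lt_min (lt_min (lt_min (lt_min (div_pos ha₄ hK₁) (div_pos (by positivity) hC₁pos)) (div_pos (by positivity) hC₁pos)) (div_pos hρ₀ hK₄))
      (div_pos (by norm_num) hK₅)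
  refine ⟨ρ₀, min a₁' aS, 178 * M, hρ₀, lt_min ha₁'0 haS, le_trans hM1 (le_mul_of_one_le_left hM0.le (by norm_num)), ?_⟩
  intro F hF n K hnK ε₁ hε₁ V hSec hVreg U₀' hU₀' hB' hε₁aS
  -- SECTOR RE-CENTRING: `hS` moves to a centre `U₀` in the same fibre that carries the lift (in the DENSITY knit: `U₀ := U₀'` itself)
  have hε₁a : ε₁ ≤ a₁' := hε₁aS.trans (min_le_left _ _)
  obtain ⟨U₀, hB, hU₀, hLiftU₀⟩ := HS ⟨(F, n, K), hF, hnK⟩ ε₁ hε₁ (hε₁aS.trans (min_le_right _ _)) V U₀' hSec hVreg hU₀' hB'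
  -- the smallness facts carried by `ε₁ ≤ a₁'`
  have h1 : ε₁ ≤ a₄ / (2 * B₀ * (L : ℝ) ^ 3 * B₃) := hε₁a.trans ((min_le_left _ _).trans ((min_le_left _ _).trans ((min_le_left _ _).trans (min_le_left _ _))))
  have h2 : ε₁ ≤ (c₁ / 2) / (L : ℝ) ^ 3 := hε₁a.trans ((min_le_left _ _).trans ((min_le_left _ _).trans ((min_le_left _ _).trans (min_le_right _ _))))
  have h3 : ε₁ ≤ (a₄ / (2 * B₁)) / (L : ℝ) ^ 3 := hε₁a.trans ((min_le_left _ _).trans ((min_le_left _ _).trans (min_le_right _ _)))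
  have h4 : ε₁ ≤ ρ₀ / (178 * M * (L : ℝ) ^ 3 * B₃) := hε₁a.trans ((min_le_left _ _).trans (min_le_right _ _))
  have h5 : ε₁ ≤ (1 / 4) / (M * (L : ℝ) ^ 3 * B₃) := hε₁a.trans (min_le_right _ _)
  have h2B : 2 * B₀ * (L : ℝ) ^ 3 * B₃ * ε₁ ≤ a₄ := by have := (le_div_iff₀ hK₁).1 h1; linarith
  have hL3c₁ : (L : ℝ) ^ 3 * ε₁ ≤ c₁ / 2 := by have := (le_div_iff₀ hC₁pos).1 h2; linarith
  have hL3a₄ : (L : ℝ) ^ 3 * ε₁ ≤ a₄ / (2 * B₁) := by have := (le_div_iff₀ hC₁pos).1 h3; linarith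
  have hwindow : 178 * M * (L : ℝ) ^ 3 * B₃ * ε₁ ≤ ρ₀ := by have := (le_div_iff₀ hK₄).1 h4; linarith
  have hquarter : M * (L : ℝ) ^ 3 * B₃ * ε₁ ≤ 1 / 4 := by have := (le_div_iff₀ hK₅).1 h5; linarith
  -- the (14)-hypotheses at the carrier
  obtain ⟨hreg, hclose⟩ := sat14T3_of_mem_fibre (h := hnK.le) (mul_pos hC₁pos hε₁) hU₀ hB
  -- C-min at ε₄ = a₄: the minimising solution `X`
  obtain ⟨X, hX3, hXh, h20, h21, hXmin⟩ := HC ⟨(F, n, K), hF, hnK⟩ ε₁ a₄ hε₁ le_rfl h2B V U₀ hVreg hreg hclose hLiftU₀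
  have hP0 : 0 ≤ (L : ℝ) ^ 3 * B₃ * ε₁ := by positivity
  have h19 : In19 F n K (M * (L : ℝ) ^ 3 * B₃ * ε₁) U₀ (expHermField X) X := by
    have hmono : 3 * B₀ * (L : ℝ) ^ 3 * B₃ * ε₁ ≤ M * (L : ℝ) ^ 3 * B₃ * ε₁ :=
      calc 3 * B₀ * (L : ℝ) ^ 3 * B₃ * ε₁ = (3 * B₀) * ((L : ℝ) ^ 3 * B₃ * ε₁) := by ring
        _ ≤ M * ((L : ℝ) ^ 3 * B₃ * ε₁) := mul_le_mul_of_nonneg_right hM3 hP0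
        _ = M * (L : ℝ) ^ 3 * B₃ * ε₁ := by ring
    exact in19_expHermField_of_nMax19_lt hXh (lt_of_lt_of_le hX3 hmono)
  have hlo : (L : ℝ) ^ 3 * B₃ * ε₁ ≤ M * (L : ℝ) ^ 3 * B₃ * ε₁ :=
    calc (L : ℝ) ^ 3 * B₃ * ε₁ = 1 * ((L : ℝ) ^ 3 * B₃ * ε₁) := (one_mul _).symm
      _ ≤ M * ((L : ℝ) ^ 3 * B₃ * ε₁) := mul_le_mul_of_nonneg_right hM1 hP0
      _ = M * (L : ℝ) ^ 3 * B₃ * ε₁ := by ring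
  obtain ⟨u, _hu, hWfib⟩ := h20 (expHermField X) h19.2.1
  have he0 : 0 < 178 * (M * (L : ℝ) ^ 3 * B₃ * ε₁) := by positivity
  have hRegW : RegPr F n K (178 * (M * (L : ℝ) ^ 3 * B₃ * ε₁)) (GaugeField.gaugeAct u (emb15 U₀ (expHermField X))) :=
    (regPr_gaugeAct_iff F he0.le u _).mpr (regPr_emb15_of_in19 (F := F) (n := n) (K := K) hquarter hlo hreg h19)
  have hWmem : GaugeField.gaugeAct u (emb15 U₀ (expHermField X)) ∈ regFibrePr F n K hnK.le (178 * (M * (L : ℝ) ^ 3 * B₃ * ε₁)) V :=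
    (mem_regFibrePr_iff F).mpr ⟨hWfib, hRegW⟩
  have hO : 178 * M * (L : ℝ) ^ 3 * B₃ * ε₁ = 178 * (M * (L : ℝ) ^ 3 * B₃ * ε₁) := by ring
  refine ⟨hwindow, GaugeField.gaugeAct u (emb15 U₀ (expHermField X)), by rw [hO]; exact hWmem, ?_⟩
  -- a competitor `U ∈ (6)(ρ) ∩ 𝔅_k(V)`, `O₁L³B₃ε₁ ≤ ρ ≤ ρ₀`
  intro ρ hρlo hρhi U hU
  have hρ0 : 0 < ρ := lt_of_lt_of_le (by rw [hO]; exact he0) hρlo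
  have h14 : Sat14T3 F n K hnK.le ((L : ℝ) ^ 3 * B₃ * ε₁) ((L : ℝ) ^ 3 * ε₁) V U₀ := ⟨hreg, hclose⟩
  have hεe : ρ ≤ min (1 / (6 * C0 3 * (L : ℝ) ^ 3)) (c2' 3 L / (4 * (L : ℝ) ^ 3)) := by
    rw [← heax_def]; exact hρhi.trans hρ₀eax
  have hB₃e : B₃ * ε₁ ≤ ρ := by
    have h0 : B₃ * ε₁ ≤ (L : ℝ) ^ 3 * B₃ * ε₁ := by
      rw [mul_assoc]; exact le_mul_of_one_le_left (by positivity) hC₁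
    have h178 : (1 : ℝ) ≤ 178 * M := le_trans hM1 (le_mul_of_one_le_left hM0.le (by norm_num))
    have h1' : (L : ℝ) ^ 3 * B₃ * ε₁ ≤ 178 * M * (L : ℝ) ^ 3 * B₃ * ε₁ :=
      calc (L : ℝ) ^ 3 * B₃ * ε₁ = 1 * ((L : ℝ) ^ 3 * B₃ * ε₁) := (one_mul _).symm
        _ ≤ (178 * M) * ((L : ℝ) ^ 3 * B₃ * ε₁) := mul_le_mul_of_nonneg_right h178 (by positivity)
        _ = 178 * M * (L : ℝ) ^ 3 * B₃ * ε₁ := by ring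
    exact h0.trans (h1'.trans hρlo)
  obtain ⟨v, hv, hvAx⟩ := axialRepr_print_based_uniform F hF hnK.le hC₁ B₃ ρ ε₁ V U₀ U hεe hB₃e h14 hU
  have hUv : GaugeField.gaugeAct v U ∈ regFibrePr F n K hnK.le ρ V :=
    (gaugeAct_mem_regFibrePr_iff_of_trivial F hnK.le hρ0.le hv U V).mpr hU
  have hUvax : IsAxialPrint F n K U₀ (GaugeField.gaugeAct v U) := hvAx _
  have hsum' : ρ + (L : ℝ) ^ 3 * ε₁ ≤ c₁ := by linarith [hρhi.trans hρ₀c₁]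
  have hε₂a₄ : B₁ * (ρ + (L : ℝ) ^ 3 * ε₁) ≤ a₄ := by
    have hρ' : ρ ≤ a₄ / (2 * B₁) := hρhi.trans hρ₀a₄
    have hs : ρ + (L : ℝ) ^ 3 * ε₁ ≤ a₄ / (2 * B₁) + a₄ / (2 * B₁) := add_le_add hρ' hL3a₄
    calc B₁ * (ρ + (L : ℝ) ^ 3 * ε₁) ≤ B₁ * (a₄ / (2 * B₁) + a₄ / (2 * B₁)) := mul_le_mul_of_nonneg_left hs hB₁.le
      _ = a₄ := by field_simp; ring
  obtain ⟨u', U₁', X', _hu', hUeq, h19', h20', h21'⟩ :=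
    HV F hF n K hnK ρ ε₁ (B₁ * (ρ + (L : ℝ) ^ 3 * ε₁)) hρ0 hε₁ hsum' le_rfl V U₀ hreg hclose (GaugeField.gaugeAct v U) hUv hUvax
  have hX'a₄ : nMax19 F n K U₀ X' < a₄ := nMax19_lt_of_in19 h19' hε₂a₄
  have hcmp := hXmin X' hX'a₄ h19'.1 h20' h21'
  have e₁' : U₁' = expHermField X' := eq_expHermField_of_in19 h19'
  have a1 : wilsonAction4 (GaugeField.gaugeAct u (emb15 U₀ (expHermField X))) = wilsonAction4 (emb15 U₀ (expHermField X)) :=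
    T4WilsonGaugeFlatDirection.wilsonAction_gaugeAct 1 u _
  have a2 : wilsonAction4 (GaugeField.gaugeAct v U) = wilsonAction4 U := T4WilsonGaugeFlatDirection.wilsonAction_gaugeAct 1 v U
  have a3 : wilsonAction4 (GaugeField.gaugeAct u' (emb15 U₀ U₁')) = wilsonAction4 (emb15 U₀ U₁') :=
    T4WilsonGaugeFlatDirection.wilsonAction_gaugeAct 1 u' _
  have a4 : wilsonAction4 (emb15 U₀ U₁') = wilsonAction4 U := by rw [← a3, hUeq, a2]
  have a5 : wilsonAction4 (emb15 U₀ (expHermField X')) = wilsonAction4 U := by rw [← e₁']; exact a4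
  show wilsonAction4 (GaugeField.gaugeAct u (emb15 U₀ (expHermField X))) ≤ wilsonAction4 U
  rw [a1, ← a5]
  exact hcmp

end Summit.QuantumFields.YangMills.Theorems.Prop7ExistRouteAlphaMinGCtrMacroSector

end
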